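import Literature.Probability.RandomPlanarGeometry.SLERestrictionLemmasKappa
import HarnessLib

/-!
# The compensated restriction martingale `h_t′(W_t)^α e^{−λ∫m}` of SLE_κ ([LSW] Prop. 5.3, Thm. 6.5): the probabilistic skeleton

General-`κ` twin of `SLERestrictionMartingale` ([LSW] Thm. 6.1 from the martingale of Prop. 5.2),
after

* G. F. Lawler, O. Schramm, W. Werner, *Conformal restriction: the chordal case*, J. Amer. Math.
  Soc. **16** (2003) 917–955, arXiv:math/0209343 (**[LSW]**), §5 Prop. 5.3: for
  `α = (6 − κ)/(2κ)`, `λ = (8 − 3κ)(6 − κ)/(2κ)`, "`Y_t = h_t′(W_t)^α exp(λ ∫₀ᵗ Sh_s(W_s)/6 ds)`,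
  `t < T`, is a local martingale. If `κ ≤ 8/3`, then `Y_t` is a bounded martingale (in fact,
  `0 ≤ Y_t ≤ 1`)"; §6 **Theorem 6.5**: "`Φ_A′(0)^α = E[1_{γ[0,∞) ∩ A = ∅} exp(λ ∫₀^∞ Sh_s(W_s)/6 ds)]`",
  with "A similar proof to that of Theorem 6.1" — i.e. (proof of Thm. 6.1, §6): "the a.s. limit
  `Y_T := lim_{t ↗ T} Y_t` exists and `Y_0 = E[Y_T]` … Lemmas 6.2 and 6.3 show that" here
  `Y_T = 1_{T = ∞} exp(λ ∫₀^∞ Sh_s(W_s)/6 ds)`.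

This file separates the inputs of that deduction for `0 < κ` and PROVES it. The compensator is
abstracted into a monotone family `L t ω ∈ [0, ∞]` (the integrated mass
`∫₀ᵗ (−Sh_s(W_s)/6) ds = ∫₀ᵗ m(A_s − W_s) ds`, `m ≥ 0`) with its total `⨆_t L t ω`, and
`e^{−λ L}` with `e^{−∞} = 0` is the real number `compFactor (λ · L)`:

* `compFactor x = e^{−x}` (`x ∈ [0, ∞]`, `e^{−∞} = 0`), its values in `[0, 1]`, antitonicity and
  continuity along monotone families (`tendsto_compFactor_of_monotone`);
* `IsRestrictionMartingaleK κ α λ A L Y` — the specification of the compensated martingale: a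
  `[0, 1]`-valued `𝓕ᵂ`-martingale which, almost surely, equals
  `Φ′_{A_t − W_t}(0)^α · compFactor (λ L_t)` at every time `t` before the hitting time `T` of `A`
  by the SLE_κ trace, is frozen at its left limit from `T` on, and has a limit at `∞` when
  `T = ∞`; with `L_0 = 0` and `t ↦ L_t` monotone (`IsRestrictionMartingale` is the case
  `κ = 8/3`, `α = 5/8`, `λ = 0`);
* the deductions, PROVED: `…ae_apply_zero` (`Y_0 = d^α`), `…integral_eq` (`E[Y_t] = d^α`),
  `…ae_tendsto_compFactor` (on `{T = ∞}`, `Y_t → compFactor (λ ⨆_t L_t)`, by Lemma 6.2 in the form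
  `sle_restrictionDeriv_frequently_gtK κ A`), `…ae_eq_zero_of_le` (on `{T < ∞}`, `Y = 0` from `T`
  on, by Lemma 6.3, `sle_restrictionDeriv_frequently_ltK κ A`), `…ae_tendsto_limit`, and
  **`…integral_limit_eq`**: `E[1_{T = ∞} · compFactor (λ ⨆_t L_t)] = Φ′_A(0)^α` (dominated
  convergence) — Theorem 6.5 for the hull `A`, given the martingale and the two limit properties.

Non-vacuity: for the empty hull the constant process `1` with `L = 0` qualifies
(`isRestrictionMartingaleK_empty`).

## References

* [LSW] Prop. 5.3 (§5); Lemmas 6.2–6.3, proofs of Thm. 6.1 and Thm. 6.5 (§6). [LawlerSchrammWerner2003Restriction]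
* G. F. Lawler, *Conformally Invariant Processes in the Plane* (2005), §6.4 Prop. 6.19. [Lawler2005]
-/

noncomputable section

open Set Filter Topology MeasureTheory
open UpperHalfPlane (upperHalfPlaneSet)
open scoped NNReal ENNReal

namespace Literature.Probability.RandomPlanarGeometry

/-! ### `e^{−x}` on `[0, ∞]` -/

/-- **`e^{−x}` for `x ∈ [0, ∞]`, with `e^{−∞} = 0`**, as a real number (the compensator
`exp(λ ∫ Sh/6) = exp(−λ ∫ m)` of [LSW] Prop. 5.3, allowing a divergent integral).
[cite: LawlerSchrammWerner2003Restriction, Prop. 5.3 (the compensator)] -/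
def compFactor (x : ℝ≥0∞) : ℝ := if x = ∞ then 0 else Real.exp (-x.toReal)

/-- `compFactor 0 = 1`. [folklore] -/
@[simp] theorem compFactor_zero : compFactor 0 = 1 := by simp [compFactor]

/-- `compFactor ∞ = 0`. [folklore] -/
@[simp] theorem compFactor_top : compFactor ∞ = 0 := by simp [compFactor]

/-- `compFactor x = e^{−x}` for finite `x`. [folklore] -/
theorem compFactor_of_ne_top {x : ℝ≥0∞} (hx : x ≠ ∞) : compFactor x = Real.exp (-x.toReal) := by
  simp [compFactor, hx]

/-- `0 ≤ compFactor x ≤ 1`. [folklore] -/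
theorem compFactor_mem_Icc (x : ℝ≥0∞) : compFactor x ∈ Icc (0 : ℝ) 1 := by
  by_cases hx : x = ∞
  · simp [compFactor, hx]
  · rw [compFactor_of_ne_top hx]
    exact ⟨(Real.exp_pos _).le, Real.exp_le_one_iff.2 (by simp)⟩

/-- `compFactor` is antitone. [folklore] -/
theorem compFactor_antitone {x y : ℝ≥0∞} (hxy : x ≤ y) : compFactor y ≤ compFactor x := by
  by_cases hy : y = ∞
  · rw [hy, compFactor_top]; exact (compFactor_mem_Icc x).1
  · have hx : x ≠ ∞ := ne_top_of_le_ne_top hy hxy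
    rw [compFactor_of_ne_top hy, compFactor_of_ne_top hx]
    exact Real.exp_le_exp.2 (neg_le_neg ((ENNReal.toReal_le_toReal hx hy).2 hxy))

/-- `compFactor x > 0` for finite `x`. [folklore] -/
theorem compFactor_pos {x : ℝ≥0∞} (hx : x ≠ ∞) : 0 < compFactor x := by
  rw [compFactor_of_ne_top hx]; exact Real.exp_pos _

/-- **Continuity of `e^{−x_t}` along a monotone family**: `compFactor (x t) → compFactor (⨆ t, x t)`
(monotone convergence of `x`, `e^{−∞} = 0`). [folklore] -/
theorem tendsto_compFactor_of_monotone {x : ℝ≥0 → ℝ≥0∞} (hmono : Monotone x) :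
    Tendsto (fun t ↦ compFactor (x t)) atTop (𝓝 (compFactor (⨆ t, x t))) := by
  have hx : Tendsto x atTop (𝓝 (⨆ t, x t)) := tendsto_atTop_iSup hmono
  by_cases htop : (⨆ t, x t) = ∞
  · rw [htop, compFactor_top]
    by_cases hfin : ∀ t, x t ≠ ∞
    · -- finite values tending to `∞`: `toReal → ∞`
      have hreal : Tendsto (fun t ↦ (x t).toReal) atTop atTop := by
        rw [tendsto_atTop]
        intro b
        have hev : ∀ᶠ t in atTop, ENNReal.ofReal b < x t := by
          rw [htop] at hx
          exact hx (Ioi_mem_nhds ENNReal.ofReal_lt_top)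
        filter_upwards [hev] with t ht
        exact (ENNReal.ofReal_le_iff_le_toReal (hfin t)).1 ht.le
      have hexp := Real.tendsto_exp_neg_atTop_nhds_zero.comp hreal
      refine hexp.congr' (Eventually.of_forall fun t ↦ ?_)
      simp [Function.comp_apply, compFactor_of_ne_top (hfin t)]
    · push Not at hfin
      obtain ⟨t₀, ht₀⟩ := hfin
      refine tendsto_const_nhds.congr' ?_
      filter_upwards [eventually_ge_atTop t₀] with t ht
      have : x t = ∞ := eq_top_iff.2 (ht₀ ▸ hmono ht)
      rw [this, compFactor_top]
  · have hfin : ∀ t, x t ≠ ∞ := fun t ↦ ne_top_of_le_ne_top htop (le_iSup x t)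
    have hreal : Tendsto (fun t ↦ (x t).toReal) atTop (𝓝 (⨆ t, x t).toReal) :=
      (ENNReal.tendsto_toReal htop).comp hx
    have hexp := (Real.continuous_exp.tendsto _).comp (hreal.neg)
    rw [compFactor_of_ne_top htop]
    refine hexp.congr' (Eventually.of_forall fun t ↦ ?_)
    simp [Function.comp_apply, compFactor_of_ne_top (hfin t)]

/-! ### The specification of the compensated restriction martingale -/

/-- **Specification of the compensated restriction martingale of SLE_κ for the hull `A`**
([LSW] Prop. 5.3 and proof of Thm. 6.5): a real process `Y` on the canonical space and a
compensator family `L t ω ∈ [0, ∞]` (the integrated Schwarzian mass `∫₀ᵗ (−Sh_s(W_s)/6) ds`) with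

* `0 ≤ Y_t ≤ 1` (Prop. 5.3: "`0 ≤ Y_t ≤ 1`");
* `Y` an `𝓕ᵂ`-martingale (Prop. 5.3: "a bounded martingale", extended past `T` by its left limit);
* `L_0 = 0`, `t ↦ L_t` monotone;
* almost surely, for every `t` before the hitting time `T` of `A` by the SLE_κ trace,
  `Y_t = Φ′_{A_t − W_t}(0)^α · compFactor (λ L_t)` (`= h_t′(W_t)^α exp(λ ∫₀ᵗ Sh_s(W_s)/6 ds)`);
* almost surely, from `T` on `Y` is frozen at its left limit, and on `{T = ∞}` it has a limit.

`IsRestrictionMartingale` (`SLERestrictionMartingale`) is the case `κ = 8/3`, `α = 5/8`, `λ = 0`.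
[cite: LawlerSchrammWerner2003Restriction, Prop. 5.3 (§5) and proofs of Thm. 6.1/6.5 (§6)] -/
structure IsRestrictionMartingaleK (κ : ℝ≥0) (α lam : ℝ) (A : Set ℂ) (L : ℝ≥0 → (ℝ≥0 → ℝ) → ℝ≥0∞)
    (Y : ℝ≥0 → (ℝ≥0 → ℝ) → ℝ) : Prop where
  /-- `0 ≤ Y_t ≤ 1`. -/
  mem_Icc : ∀ t ω, Y t ω ∈ Icc (0 : ℝ) 1
  /-- `Y` is an `𝓕ᵂ`-martingale under the pre-Wiener measure. -/
  martingale : Martingale Y brownianFiltration Process.preWienerMeasure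
  /-- The compensator starts at `0`. -/
  L_zero : ∀ ω, L 0 ω = 0
  /-- The compensator is monotone. -/
  L_mono : ∀ ω, Monotone fun t ↦ L t ω
  /-- A.s., before the hitting time, `Y_t = Φ'_{A_t − W_t}(0)^α · e^{−λ L_t}`. -/
  ae_exists_eq : ∀ᵐ ω ∂Process.preWienerMeasure, ∀ t : ℝ≥0,
    (t : WithTop ℝ≥0) < firstHit (sleTrace κ ω) A →
      ∃ (Ψ : ConformalEquiv (upperHalfPlaneSet \ Loewner.slidHull (sleDriving κ ω) A t) upperHalfPlaneSet) (e : ℝ),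
        IsRestrictionMap (Loewner.slidHull (sleDriving κ ω) A t) Ψ ∧
          HasRestrictionDeriv (Loewner.slidHull (sleDriving κ ω) A t) Ψ e ∧
          0 < e ∧ e ≤ 1 ∧ Y t ω = e ^ α * compFactor (ENNReal.ofReal lam * L t ω)
  /-- A.s., from the hitting time `T < ∞` on, `Y` equals its left limit at `T`. -/
  ae_frozen : ∀ᵐ ω ∂Process.preWienerMeasure, ∀ τ : ℝ≥0, firstHit (sleTrace κ ω) A = τ →
    ∀ t : ℝ≥0, τ ≤ t → Tendsto (fun s ↦ Y s ω) (𝓝[<] τ) (𝓝 (Y t ω))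
  /-- A.s., if `A` is never hit (`T = ∞`), the limit `lim_{t → ∞} Y_t` exists. -/
  ae_exists_tendsto : ∀ᵐ ω ∂Process.preWienerMeasure, firstHit (sleTrace κ ω) A = ⊤ →
    ∃ c : ℝ, Tendsto (fun t ↦ Y t ω) atTop (𝓝 c)

/-! ### Non-vacuity: the empty hull -/

/-- **The constant process `1` with compensator `0` is a compensated restriction martingale for the
empty hull.** [folklore] -/
theorem isRestrictionMartingaleK_empty (κ : ℝ≥0) (α lam : ℝ) :
    IsRestrictionMartingaleK κ α lam ∅ (fun _ _ ↦ 0) (fun _ _ ↦ 1) where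
  mem_Icc _ _ := ⟨zero_le_one, le_rfl⟩
  martingale := by
    haveI := isProbabilityMeasure_preWienerMeasure'
    exact martingale_const _ _ _
  L_zero _ := rfl
  L_mono _ := monotone_const
  ae_exists_eq := Eventually.of_forall fun ω t _ ↦ by
    have h := Loewner.slidHull_empty (sleDriving κ ω) t
    obtain ⟨Ψ, e, hΨ, he, he0, he1, h1⟩ := exists_isRestrictionMap_of_eq_empty h
    refine ⟨Ψ, e, hΨ, he, he0, he1, ?_⟩
    -- `e = 1` (from `1 = e^{5/8}`, `0 < e ≤ 1`)
    have he1' : e = 1 := by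
      by_contra hne
      have hlt : e < 1 := lt_of_le_of_ne he1 hne
      have : e ^ ((5 : ℝ) / 8) < 1 := Real.rpow_lt_one he0.le hlt (by norm_num)
      linarith
    simp [he1']
  ae_frozen := Eventually.of_forall fun _ _ _ _ _ ↦ tendsto_const_nhds
  ae_exists_tendsto := Eventually.of_forall fun _ _ ↦ ⟨1, tendsto_const_nhds⟩

/-! ### Deductions -/

section Deduction

variable {κ : ℝ≥0} {α lam : ℝ} {A : Set ℂ} {L : ℝ≥0 → (ℝ≥0 → ℝ) → ℝ≥0∞} {Y : ℝ≥0 → (ℝ≥0 → ℝ) → ℝ}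
  {Φ : ConformalEquiv (upperHalfPlaneSet \ A) upperHalfPlaneSet} {d : ℝ}

/-- `Y_0 = Φ'_A(0)^α` almost surely (`A_0 − W_0 = A`, uniqueness of `Φ_A`, `L_0 = 0`). [folklore] -/
theorem IsRestrictionMartingaleK.ae_apply_zero (huniq : IsStarHull.existsUnique_isRestrictionMap)
    (hA : IsStarHull A) (hΦ : IsRestrictionMap A Φ) (hd : HasRestrictionDeriv A Φ d)
    (hY : IsRestrictionMartingaleK κ α lam A L Y) :
    ∀ᵐ ω ∂Process.preWienerMeasure, Y 0 ω = d ^ α := by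
  have key : ∀ B : Set ℂ, B = A →
      ∀ (Ψ : ConformalEquiv (upperHalfPlaneSet \ B) upperHalfPlaneSet) (e : ℝ),
        IsRestrictionMap B Ψ → HasRestrictionDeriv B Ψ e → e = d := by
    rintro B rfl Ψ e hΨ he
    exact HasRestrictionDeriv.eq_of_isRestrictionMap huniq hA hΦ hΨ hd he
  filter_upwards [hY.ae_exists_eq] with ω hω
  obtain ⟨Ψ, e, hΨ, he, -, -, h0⟩ := hω 0 (firstHit_sleTrace_pos _ hA.isBoundedHull.isClosed hA.zero_notMem ω)
  rw [h0, key _ (slidHull_sleDriving_zero _ hA.zero_notMem ω) Ψ e hΨ he, hY.L_zero ω]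
  simp

/-- **`E[Y_t] = Φ'_A(0)^α`** (martingale property). [folklore] -/
theorem IsRestrictionMartingaleK.integral_eq
    (huniq : IsStarHull.existsUnique_isRestrictionMap) (hA : IsStarHull A)
    (hΦ : IsRestrictionMap A Φ) (hd : HasRestrictionDeriv A Φ d) (hY : IsRestrictionMartingaleK κ α lam A L Y)
    (t : ℝ≥0) : ∫ ω, Y t ω ∂Process.preWienerMeasure = d ^ α := by
  haveI := isProbabilityMeasure_preWienerMeasure'
  have h := hY.martingale.setIntegral_eq (show (0 : ℝ≥0) ≤ t from bot_le) (MeasurableSet.univ (α := ℝ≥0 → ℝ))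
  simp only [Measure.restrict_univ] at h
  rw [← h, integral_congr_ae (hY.ae_apply_zero huniq hA hΦ hd), integral_const, smul_eq_mul, probReal_univ, one_mul]

/-- **On `{T = ∞}`: `Y_t → compFactor (λ ⨆_t L_t)`** ("Lemma 6.2 shows …"): the limit of `Y` exists,
`Y_t = e_t^α C_t ≤ C_t ↓ C_∞`, and by Lemma 6.2 `e_t > 1 − ε` at arbitrarily large times, so the
limit is at least `(1 − ε)^α C_∞` for every `ε`. [cite: LawlerSchrammWerner2003Restriction, proofs of Thm. 6.1/6.5 (§6)] -/
theorem IsRestrictionMartingaleK.ae_tendsto_compFactor (hα : 0 < α) (hY : IsRestrictionMartingaleK κ α lam A L Y)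
    (h62 : sle_restrictionDeriv_frequently_gtK κ A) :
    ∀ᵐ ω ∂Process.preWienerMeasure, firstHit (sleTrace κ ω) A = ⊤ →
      Tendsto (fun t ↦ Y t ω) atTop (𝓝 (compFactor (ENNReal.ofReal lam * ⨆ t, L t ω))) := by
  filter_upwards [hY.ae_exists_eq, hY.ae_exists_tendsto, h62] with ω hrpow hlim hgt hT
  obtain ⟨c, hc⟩ := hlim hT
  -- the compensator along the path
  set x : ℝ≥0 → ℝ≥0∞ := fun t ↦ ENNReal.ofReal lam * L t ω with hx
  have hxmono : Monotone x := fun s t hst ↦ by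
    show ENNReal.ofReal lam * L s ω ≤ ENNReal.ofReal lam * L t ω
    gcongr
    exact hY.L_mono ω hst
  have hxsup : (⨆ t, x t) = ENNReal.ofReal lam * ⨆ t, L t ω := by
    exact (ENNReal.mul_iSup _ _).symm
  have hC := tendsto_compFactor_of_monotone hxmono
  rw [hxsup] at hC
  set Cinf := compFactor (ENNReal.ofReal lam * ⨆ t, L t ω) with hCinf
  suffices hc1 : c = Cinf by rwa [hc1] at hc
  have hT' : ∀ t : ℝ≥0, (t : WithTop ℝ≥0) < firstHit (sleTrace κ ω) A := fun t ↦ by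
    rw [hT]; exact WithTop.coe_lt_top t
  -- `Y_t ≤ C_t`, hence `c ≤ Cinf`
  have hYle : ∀ t, Y t ω ≤ compFactor (x t) := fun t ↦ by
    obtain ⟨Ψ, e, -, -, he0, he1, hYt⟩ := hrpow t (hT' t)
    rw [hYt]
    have h1 : e ^ α ≤ 1 := Real.rpow_le_one he0.le he1 hα.le
    have h0 := (compFactor_mem_Icc (x t)).1
    calc e ^ α * compFactor (x t) ≤ 1 * compFactor (x t) := mul_le_mul_of_nonneg_right h1 h0
      _ = compFactor (x t) := one_mul _
  have hle : c ≤ Cinf := le_of_tendsto_of_tendsto' hc hC hYle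
  have hC0 : 0 ≤ Cinf := (compFactor_mem_Icc _).1
  -- `c ≥ (1 − ε)^α Cinf` for every small `ε > 0`
  have hge : ∀ ε : ℝ, 0 < ε → ε < 1 → (1 - ε) ^ α * Cinf ≤ c := by
    intro ε hε hε1
    have hCt : ∀ t, Cinf ≤ compFactor (x t) := fun t ↦
      compFactor_antitone (by rw [← hxsup]; exact le_iSup x t)
    have hfreq : ∃ᶠ t : ℝ≥0 in atTop, (1 - ε) ^ α * Cinf ≤ Y t ω := by
      refine (hgt hT ε hε).mp (Eventually.of_forall fun t ht ↦ ?_)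
      obtain ⟨Ψ, e, hΨ, he, he0, he1, hYt⟩ := hrpow t (hT' t)
      have h1 : 1 - ε < e := ht Ψ e hΨ he
      rw [hYt]
      have h2 : (1 - ε) ^ α ≤ e ^ α := Real.rpow_le_rpow (by linarith) h1.le hα.le
      exact mul_le_mul h2 (hCt t) hC0 (Real.rpow_nonneg he0.le _)
    by_contra hlt
    push Not at hlt
    have hev : ∀ᶠ t : ℝ≥0 in atTop, Y t ω < (1 - ε) ^ α * Cinf := hc (Iio_mem_nhds hlt)
    obtain ⟨t, ht1, ht2⟩ := (hfreq.and_eventually hev).exists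
    exact lt_irrefl _ (ht1.trans_lt ht2)
  -- let `ε → 0`
  have hlimε : Tendsto (fun ε : ℝ ↦ (1 - ε) ^ α * Cinf) (𝓝[>] 0) (𝓝 ((1 - 0) ^ α * Cinf)) := by
    have hcont : ContinuousAt (fun ε : ℝ ↦ (1 - ε) ^ α * Cinf) 0 := by
      have h1 : ContinuousAt (fun ε : ℝ ↦ (1 - ε) ^ α) 0 :=
        ContinuousAt.rpow_const (continuousAt_const.sub continuousAt_id) (Or.inl (by norm_num))
      exact h1.mul continuousAt_const
    exact hcont.tendsto.mono_left nhdsWithin_le_nhds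
  rw [sub_zero, Real.one_rpow, one_mul] at hlimε
  have hge' : Cinf ≤ c := by
    refine le_of_tendsto hlimε ?_
    have : Ioo (0 : ℝ) 1 ∈ 𝓝[>] (0 : ℝ) := Ioo_mem_nhdsGT one_pos
    filter_upwards [this] with ε hε
    exact hge ε hε.1 hε.2
  exact le_antisymm hle hge'

/-- **On `{T < ∞}`: `Y = 0` from time `T` on** ("Lemma 6.3 shows …"): `Y` is frozen at its left
limit at `T`, and `Y_s = e_s^α C_s ≤ e_s^α` comes below any `ε > 0` as `s ↗ T` (Lemma 6.3, with
`e_s < ε^{1/α}`). [cite: LawlerSchrammWerner2003Restriction, proofs of Thm. 6.1/6.5 (§6)] -/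
theorem IsRestrictionMartingaleK.ae_eq_zero_of_le (hα : 0 < α) (hA : IsStarHull A)
    (hY : IsRestrictionMartingaleK κ α lam A L Y) (h63 : sle_restrictionDeriv_frequently_ltK κ A) :
    ∀ᵐ ω ∂Process.preWienerMeasure, ∀ τ : ℝ≥0, firstHit (sleTrace κ ω) A = τ →
      ∀ t : ℝ≥0, τ ≤ t → Y t ω = 0 := by
  filter_upwards [hY.ae_exists_eq, hY.ae_frozen, h63] with ω hrpow hfrozen hsmall τ hτ t hτt
  have hτ0 : 0 < τ := by
    have h := firstHit_sleTrace_pos κ hA.isBoundedHull.isClosed hA.zero_notMem ω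
    rw [hτ] at h
    exact_mod_cast h
  haveI : (𝓝[<] τ).NeBot := nhdsLT_neBot_of_exists_lt ⟨0, hτ0⟩
  have hlim : Tendsto (fun s ↦ Y s ω) (𝓝[<] τ) (𝓝 (Y t ω)) := hfrozen τ hτ t hτt
  have hlt : ∀ᶠ s : ℝ≥0 in 𝓝[<] τ, (s : WithTop ℝ≥0) < firstHit (sleTrace κ ω) A := by
    filter_upwards [self_mem_nhdsWithin] with s hs
    rw [hτ]
    exact_mod_cast hs
  -- `Y_s < ε'` arbitrarily close to `τ`
  have hfreq : ∀ ε' : ℝ, 0 < ε' → ∃ᶠ s : ℝ≥0 in 𝓝[<] τ, Y s ω < ε' := by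
    intro ε' hε'
    have hε : 0 < ε' ^ (1 / α) := Real.rpow_pos_of_pos hε' _
    refine ((hsmall τ hτ _ hε).and_eventually hlt).mp (Eventually.of_forall ?_)
    rintro s ⟨hs, hsT⟩
    obtain ⟨Ψ, e, hΨ, he, he0, -, hYs⟩ := hrpow s hsT
    have hes : e < ε' ^ (1 / α) := hs Ψ e hΨ he
    rw [hYs]
    have hC := compFactor_mem_Icc (ENNReal.ofReal lam * L s ω)
    calc e ^ α * compFactor (ENNReal.ofReal lam * L s ω) ≤ e ^ α * 1 :=
          mul_le_mul_of_nonneg_left hC.2 (Real.rpow_nonneg he0.le _)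
      _ = e ^ α := mul_one _
      _ < (ε' ^ (1 / α)) ^ α := Real.rpow_lt_rpow he0.le hes hα
      _ = ε' := by rw [← Real.rpow_mul hε'.le, one_div_mul_cancel hα.ne', Real.rpow_one]
  have hle : ∀ ε' : ℝ, 0 < ε' → Y t ω ≤ ε' := fun ε' hε' ↦ by
    by_contra hgt
    push Not at hgt
    obtain ⟨s, hs1, hs2⟩ := ((hfreq ε' hε').and_eventually (hlim (Ioi_mem_nhds hgt))).exists
    exact lt_irrefl _ (hs1.trans hs2)
  refine le_antisymm (le_of_forall_pos_lt_add fun ε hε ↦ ?_) (hY.mem_Icc t ω).1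
  linarith [hle (ε / 2) (half_pos hε)]

/-- **`Y_t → 1_{T = ∞} · compFactor (λ ⨆_t L_t)` almost surely**, for a compensated restriction
martingale of a `*`-hull `A` having the two limit properties. [cite: LawlerSchrammWerner2003Restriction, proof of Thm. 6.5 (§6)] -/
theorem IsRestrictionMartingaleK.ae_tendsto_limit (hα : 0 < α) (hA : IsStarHull A)
    (hY : IsRestrictionMartingaleK κ α lam A L Y) (h62 : sle_restrictionDeriv_frequently_gtK κ A)
    (h63 : sle_restrictionDeriv_frequently_ltK κ A) :
    ∀ᵐ ω ∂Process.preWienerMeasure, Tendsto (fun t ↦ Y t ω) atTop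
      (𝓝 (if firstHit (sleTrace κ ω) A = ⊤ then compFactor (ENNReal.ofReal lam * ⨆ t, L t ω) else 0)) := by
  filter_upwards [hY.ae_tendsto_compFactor hα h62, hY.ae_eq_zero_of_le hα hA h63] with ω h1 h0
  split_ifs with hT
  · exact h1 hT
  · obtain ⟨τ, hτ⟩ := WithTop.ne_top_iff_exists.1 hT
    refine tendsto_const_nhds.congr' ?_
    filter_upwards [eventually_ge_atTop τ] with t ht
    exact (h0 τ hτ.symm t ht).symm

/-- **[LSW] Theorem 6.5 for the hull `A`, from its compensated restriction martingale and the two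
limit properties**: `E[1_{T = ∞} · compFactor (λ ⨆_t L_t)] = Φ′_A(0)^α`, the limit being an a.e.
limit of the martingale values (hence a.e.-strongly measurable) — dominated convergence
(`0 ≤ Y ≤ 1`) and `E[Y_n] = Φ′_A(0)^α`. [cite: LawlerSchrammWerner2003Restriction, Thm. 6.5 and its proof (§6)] -/
theorem IsRestrictionMartingaleK.integral_limit_eq (hα : 0 < α) (huniq : IsStarHull.existsUnique_isRestrictionMap) (hA : IsStarHull A)
    (hΦ : IsRestrictionMap A Φ) (hd : HasRestrictionDeriv A Φ d) (hY : IsRestrictionMartingaleK κ α lam A L Y)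
    (h62 : sle_restrictionDeriv_frequently_gtK κ A) (h63 : sle_restrictionDeriv_frequently_ltK κ A) :
    AEStronglyMeasurable (fun ω ↦ if firstHit (sleTrace κ ω) A = ⊤ then
        compFactor (ENNReal.ofReal lam * ⨆ t, L t ω) else 0) Process.preWienerMeasure ∧
      ∫ ω, (if firstHit (sleTrace κ ω) A = ⊤ then compFactor (ENNReal.ofReal lam * ⨆ t, L t ω) else 0)
        ∂Process.preWienerMeasure = d ^ α := by
  haveI := isProbabilityMeasure_preWienerMeasure'
  set P : Measure (ℝ≥0 → ℝ) := Process.preWienerMeasure with hP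
  set f : (ℝ≥0 → ℝ) → ℝ := fun ω ↦ if firstHit (sleTrace κ ω) A = ⊤ then
    compFactor (ENNReal.ofReal lam * ⨆ t, L t ω) else 0 with hf
  have hint : ∀ n : ℕ, ∫ ω, Y n ω ∂P = d ^ α := fun n ↦ hY.integral_eq huniq hA hΦ hd n
  have hmeas : ∀ n : ℕ, AEStronglyMeasurable (Y n) P := fun n ↦ (hY.martingale.integrable _).aestronglyMeasurable
  have hlim' : ∀ᵐ ω ∂P, Tendsto (fun n : ℕ ↦ Y n ω) atTop (𝓝 (f ω)) := by
    filter_upwards [hY.ae_tendsto_limit hα hA h62 h63] with ω hω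
    exact hω.comp tendsto_natCast_atTop_atTop
  have hbound : ∀ n : ℕ, ∀ᵐ ω ∂P, ‖Y n ω‖ ≤ (1 : ℝ) := fun n ↦
    Eventually.of_forall fun ω ↦ by
      rw [Real.norm_eq_abs, abs_le]
      have h := hY.mem_Icc n ω
      exact ⟨by linarith [h.1], h.2⟩
  have hDCT := tendsto_integral_of_dominated_convergence (fun _ ↦ (1 : ℝ)) hmeas (integrable_const 1) hbound hlim'
  have hfm : AEStronglyMeasurable f P := aestronglyMeasurable_of_tendsto_ae atTop hmeas hlim'
  refine ⟨hfm, tendsto_nhds_unique hDCT ?_⟩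
  simp_rw [hint]
  exact tendsto_const_nhds

end Deduction

end Literature.Probability.RandomPlanarGeometry

end
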